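import Mathlib
import Literature.AlgebraicGeometry.Ramification.InertiaNormalSylow
import HarnessLib

/-!
# The normal Phase-0 model has a `G`-stable affine cover (crux `WildQuotients.WildQuotientResolution`, stub `stub_phaseZeroHighDim`)

Crux stmt-ResolutionOfSingularities-15640 (`WildQuotientResolution`), line `Sketch`, registered stub
`stub_phaseZeroHighDim`, last clause: every point of the model `Xs` lies in an AFFINE open `U` with
`(ρs g)⁻¹ U = U` for all `g`. For the conditional normal Phase-0 model `Xs = f′.normalization` of
✓`PhaseZeroNormalModel.exists_normalModel_forall_hasNormalSylow` (the integral closure of the blown-up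
quotient `Q′` in the stable open `V`, with the induced action `normalizationAction`, AS2011 2.4) this clause
is free: `Xs → Q′` is affine (integral) and `G`-invariant, so the preimage of any affine open of `Q′` is a
`G`-stable affine open of `Xs`.

* `exists_stable_affineOpen_normalization` — the clause, for any qcqs `f : V → Y` and any action of `G` on
  `V` over `Y`.

[OURS · crux stmt-ResolutionOfSingularities-15640 · helper toward `stub_phaseZeroHighDim`; folklore,
counted 0; AI-level work, weaker than expert review.]
-/

-- single-problem summit: the doubled namespace component `ResolutionOfSingularities` is forced
set_option linter.dupNamespace false

noncomputable section

universe u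

open CategoryTheory CategoryTheory.Limits AlgebraicGeometry TopologicalSpace
open Literature.AlgebraicGeometry.Ramification

namespace Summit.ResolutionOfSingularities.ResolutionOfSingularities.Theorems.WildQuotientResolution.NormalizationStableCover

/-- **Every point of the relative normalisation has a `G`-stable affine open neighbourhood**: for a qcqs
`f : V → Y` and an action `ρ` of `G` on `V` over `Y`, the induced action on `f.normalization`
(`normalizationAction`) is over `Y` (`normalizationAction_hom_fromNormalization`), and
`f.normalization → Y` is affine; so the preimage of an affine open neighbourhood of the image of `x` in
`Y` is an affine, `G`-stable open containing `x`. [folklore; cf. AbbesSaito2011, 2.4] -/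
theorem exists_stable_affineOpen_normalization {G : Type*} [Group G] {V Y : Scheme.{u}} (f : V ⟶ Y)
    [QuasiCompact f] [QuasiSeparated f] (ρ : G →* Aut V) (hρ : ∀ g : G, (ρ g).hom ≫ f = f)
    (x : ↥f.normalization) :
    ∃ U : f.normalization.Opens, IsAffineOpen U ∧ x ∈ U ∧
      ∀ g : G, (normalizationAction f ρ hρ g).hom ⁻¹ᵁ U = U := by
  obtain ⟨W, hW, hxW, -⟩ := exists_isAffineOpen_mem_and_subset (X := Y)
    (x := f.fromNormalization.base x) (U := ⊤) (Opens.mem_top _)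
  refine ⟨f.fromNormalization ⁻¹ᵁ W, hW.preimage f.fromNormalization, hxW, fun g => ?_⟩
  rw [← Scheme.Hom.comp_preimage, normalizationAction_hom_fromNormalization]

end Summit.ResolutionOfSingularities.ResolutionOfSingularities.Theorems.WildQuotientResolution.NormalizationStableCover

end
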